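import Literature.Analysis.FunctionSpaces.MinlosBorelProofs
import Literature.Analysis.FunctionSpaces.NuclearSpaceSchwartzSeparableProofs
import HarnessLib

/-!
# Discharged fact: a finite law on `𝒮'(E)` is determined by its generating functional

`Literature/MathematicalPhysics/QuantumLattice/RandomField.lean` records, as the named fact
`Literature.MathematicalPhysics.QuantumLattice.ext_of_genFunctional`, that for a finite-dimensional real normed space `E` two finite
Borel measures on the space of field configurations `FieldConfig E = 𝓢(E, ℝ) →Lₚₜ[ℝ] ℝ` (real
tempered distributions, weak-* topology, Borel σ-algebra) with the same generating functional
`f ↦ ∫ exp (i ω(f)) dμ(ω)` coincide (Gel'fand–Vilenkin IV, Ch. IV: a measure on the dual of a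
nuclear space is determined by its characteristic functional; Yamasaki 1985, Part A §16, Thm 16.2:
characteristic functions correspond one-to-one with measures on the cylinder σ-algebra). This file
proves it:

* `Literature.AQFT.ext_of_genFunctional_holds : ext_of_genFunctional (E := E)`,

so that the two dependents holding `(h : ext_of_genFunctional)` can be fed the theorem.

## Proof

The three ingredients are already in `Literature`:

1. `𝓢(E, ℝ)` is separable for finite-dimensional `E` (`Literature.Analysis.FunctionSpaces.separableSpace_schwartzMap_holds`,
   `Literature/Analysis/FunctionSpaces/NuclearSpaceSchwartzSeparableProofs.lean`; Trèves 1967,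
   Appendix p. 556) and first countable (Mathlib `SchwartzMap.instFirstCountableTopology`).
2. Hence the Borel σ-algebra of the weak-* topology on `FieldConfig E` is the cylinder σ-algebra
   `Literature.dualCylinderSigma 𝓢(E, ℝ)` generated by the evaluations `ω ↦ ω f`
   (`Literature.Analysis.FunctionSpaces.borel_eq_dualCylinderSigma_of_separableSpace`,
   `Literature/Analysis/FunctionSpaces/MinlosBorelProofs.lean`; Fernique 1967, Ch. III; Trèves
   1967, Prop. A.9: the weak dual of a separable Fréchet space is a Souslin space).
3. On the cylinder σ-algebra two finite measures with the same generating functional coincide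
   (`Literature.Analysis.FunctionSpaces.ext_of_genFunctionalOf_eq`, `Literature/Analysis/FunctionSpaces/MinlosProofs.lean`:
   the finite-dimensional marginals agree by Mathlib's `MeasureTheory.Measure.ext_of_charFun`,
   and the measurable cylinders form a generating π-system; Yamasaki 1985, Part A §16, Thm 16.2).

Since `genFunctionalOf μ f = genFunctional μ f` definitionally
(`Literature.Analysis.FunctionSpaces.genFunctionalOf_eq_genFunctional`), the three combine to the accepted statement. No
nuclearity of `𝓢(E, ℝ)` is used (it is needed for the existence half of Minlos' theorem only).

## References

* I. M. Gel'fand, N. Ya. Vilenkin, *Generalized Functions IV: Applications of Harmonic Analysis*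
  (1964), Ch. IV §§1–4 (cylinder sets; characteristic functionals of measures on duals of
  nuclear spaces; Minlos' theorem). [GelfandVilenkinIV1964]
* Y. Yamasaki, *Measures on infinite dimensional spaces* (1985), Part A §16, Thm 16.2.
  [Yamasaki1985]
* H.-H. Kuo, *White noise distribution theory* (1996), §2.3, Fact 2.4 (p. 46). [Kuo1996]
* J. Glimm, A. Jaffe, *Quantum physics: a functional integral point of view*, 2nd ed. (1987),
  §3.4, Thm 3.4.2 (Minlos) and the Remark following it. [GlimmJaffeQP1987]
* F. Trèves, *Topological vector spaces, distributions and kernels* (1967), Appendix, p. 556 and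
  Prop. A.9. [Treves1967]
* X. Fernique, *Processus linéaires, processus généralisés*, Ann. Inst. Fourier 17 (1967),
  Ch. III. [Fernique1967]
-/

open scoped SchwartzMap
open MeasureTheory TopologicalSpace

namespace Literature.MathematicalPhysics.QuantumLattice

variable {E : Type*} [NormedAddCommGroup E] [NormedSpace ℝ E]

/-- On `FieldConfig E = 𝒮'(E)` over a finite-dimensional `E`, the Borel σ-algebra of the weak-*
topology (the registered measurable structure `FieldConfig.instMeasurableSpace`) is the cylinder
σ-algebra generated by the evaluations `ω ↦ ω f`, `f ∈ 𝓢(E, ℝ)`: `𝓢(E, ℝ)` is separable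
(`separableSpace_schwartzMap_holds`) and first countable, so
`borel_eq_dualCylinderSigma_of_separableSpace` applies. Trèves 1967, Appendix Prop. A.9 (weak
duals of separable Fréchet spaces are Souslin spaces); Fernique 1967, Ch. III.
[cite: Treves1967, Appendix Prop. A.9] -/
theorem borel_fieldConfig_eq_dualCylinderSigma [FiniteDimensional ℝ E] :
    borel (FieldConfig E) = Literature.Analysis.FunctionSpaces.dualCylinderSigma 𝓢(E, ℝ) := by
  haveI : SeparableSpace 𝓢(E, ℝ) := Literature.Analysis.FunctionSpaces.separableSpace_schwartzMap_holds E ℝ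
  exact Literature.Analysis.FunctionSpaces.borel_eq_dualCylinderSigma_of_separableSpace 𝓢(E, ℝ)

/-- Discharge of the named fact `Literature.MathematicalPhysics.QuantumLattice.ext_of_genFunctional`: **two finite Borel measures on
`𝒮'(E) = FieldConfig E` (finite-dimensional `E`) with the same generating functional coincide.**
Borel = cylinder (`borel_fieldConfig_eq_dualCylinderSigma`) and uniqueness on the cylinder
σ-algebra (`Literature.Analysis.FunctionSpaces.ext_of_genFunctionalOf_eq`: finite-dimensional marginals via
`Measure.ext_of_charFun`, π-system of cylinders). Gel'fand–Vilenkin IV, Ch. IV (a measure on the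
dual of a nuclear space is determined by its characteristic functional); Yamasaki 1985, Part A
§16, Thm 16.2 (one-to-one correspondence between characteristic functions and measures on the
cylinder σ-algebra); Glimm–Jaffe, Thm 3.4.2 (Minlos: a *unique* Borel probability measure on
`𝒟'(ℝᵈ)`, supported on `𝒮'(ℝᵈ)` when the functional is `𝒮`-continuous, Remark following it);
Kuo 1996, §2.3 Fact 2.4 (Minlos' theorem with uniqueness, referred there to Gel'fand–Vilenkin).
[cite: GelfandVilenkinIV1964, Ch. IV §4.1] [cite: Yamasaki1985, Part A §16, Thm 16.2]
[cite: GlimmJaffeQP1987, §3.4 Thm 3.4.2] [cite: Kuo1996, §2.3 Fact 2.4] -/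
theorem ext_of_genFunctional_holds : ext_of_genFunctional (E := E) := by
  intro _ μ ν _ _ h
  exact Literature.Analysis.FunctionSpaces.ext_of_genFunctionalOf_eq
    ((BorelSpace.measurable_eq (α := FieldConfig E)).trans borel_fieldConfig_eq_dualCylinderSigma)
    fun f => congrFun h f

end Literature.MathematicalPhysics.QuantumLattice
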